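import Mathlib

/-!
# Parseval's identity on circles for a power series

For a power series `f(z) = Σ_n a_n zⁿ` converging on the open unit disc and `0 ≤ r < 1`:

* `Σ_n |a_n| rⁿ < ∞` (`summable_norm_mul_pow`: the terms at a larger radius `r' ∈ (r, 1)` are bounded,
  so the series at `r` is dominated by a geometric series) and the partial sums converge UNIFORMLY on
  `|z| ≤ r` (`tendstoUniformlyOn_partialSum`, Weierstrass' M-test);
* `∫_{-π}^{π} |f(r e^{iθ})|² dθ = 2π Σ_n |a_n|² r^{2n}` (`hasSum_circle_parseval`): the finite identity
  `∫ |Σ_{n<N} a_n rⁿ e^{inθ}|² dθ = 2π Σ_{n<N} |a_n|² r^{2n}` (orthogonality `∫ e^{i(n-m)θ} dθ = 2π δ_{nm}`)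
  passed to the limit by the uniform convergence.

This is the circle-by-circle input for Parseval's identity in the weighted Bergman space
(`T5BergmanParseval`): the norms of the higher `K`-types of `T5BergmanMonomialNorm` are the weights
of the `ℓ²`-isomorphism `f ↦ (a_n)`.

Blind lane: Mathlib only; no sorry; axioms ⊆ {propext, Classical.choice, Quot.sound}.
-/

namespace Summit.Ventures.HodgeRepro2.T5CircleParseval

open MeasureTheory Metric Filter Topology Complex
open scoped Real

/-! ### The orthogonality integral -/

/-- `exp(kπi) = exp(-kπi)` for `k ∈ ℤ` (both equal `(-1)^k`). -/
lemma exp_int_mul_pi_I_eq (k : ℤ) : exp ((k : ℂ) * (π * I)) = exp ((k : ℂ) * (-(π * I))) := by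
  rw [exp_int_mul, exp_int_mul, exp_pi_mul_I, exp_neg, exp_pi_mul_I, inv_neg_one]

/-- `∫_{-π}^{π} e^{ikθ} dθ = 0` for `k ∈ ℤ`, `k ≠ 0`. -/
lemma integral_exp_int_mul_I (k : ℤ) (hk : k ≠ 0) :
    ∫ θ in (-π)..π, exp ((k : ℂ) * I * θ) = 0 := by
  have hc : (k : ℂ) * I ≠ 0 := mul_ne_zero (by exact_mod_cast hk) I_ne_zero
  rw [integral_exp_mul_complex hc, div_eq_zero_iff]
  left
  rw [sub_eq_zero]
  have := exp_int_mul_pi_I_eq k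
  convert this using 2 <;> push_cast <;> ring

/-- **Orthogonality of the characters** `e^{inθ}` on `(-π, π)`:
`∫_{(-π,π)} e^{i(n-m)θ} dθ = 2π δ_{nm}`. -/
lemma integral_Ioo_exp_sub (n m : ℕ) :
    ∫ θ in Set.Ioo (-π) π, exp (((n : ℂ) - m) * I * θ) = if n = m then (2 * π : ℂ) else 0 := by
  rw [← integral_Ioc_eq_integral_Ioo,
    ← intervalIntegral.integral_of_le (by linarith [Real.pi_pos] : -π ≤ π)]
  split_ifs with h
  · subst h
    simp only [sub_self, zero_mul, exp_zero, intervalIntegral.integral_const, sub_neg_eq_add,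
      Complex.real_smul, mul_one]
    push_cast
    ring
  · have hk : ((n : ℤ) - m) ≠ 0 := sub_ne_zero.mpr (by exact_mod_cast h)
    have := integral_exp_int_mul_I ((n : ℤ) - m) hk
    push_cast at this
    exact this

/-! ### The partial sums on the circle -/

/-- `(r e^{iθ})ⁿ = rⁿ e^{inθ}`. -/
lemma circleMap_zero_pow (r θ : ℝ) (n : ℕ) :
    (circleMap 0 r θ) ^ n = (r : ℂ) ^ n * exp ((n : ℂ) * I * θ) := by
  rw [circleMap, zero_add, mul_pow, ← exp_nat_mul]
  ring_nf

/-- `conj (r e^{iθ})ᵐ = rᵐ e^{-imθ}`. -/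
lemma conj_circleMap_zero_pow (r θ : ℝ) (m : ℕ) :
    (starRingEnd ℂ) ((circleMap 0 r θ) ^ m) = (r : ℂ) ^ m * exp (-(m : ℂ) * I * θ) := by
  rw [circleMap_zero_pow, map_mul, map_pow, conj_ofReal, ← exp_conj]
  congr 2
  simp only [map_mul, conj_natCast, conj_I, conj_ofReal]
  ring

/-- The term-by-term product `(r e^{iθ})ⁿ · conj (r e^{iθ})ᵐ = r^{n+m} e^{i(n-m)θ}`. -/
lemma circleMap_zero_pow_mul_conj (r θ : ℝ) (n m : ℕ) :
    (circleMap 0 r θ) ^ n * (starRingEnd ℂ) ((circleMap 0 r θ) ^ m) =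
      (r : ℂ) ^ (n + m) * exp (((n : ℂ) - m) * I * θ) := by
  rw [circleMap_zero_pow, conj_circleMap_zero_pow, pow_add]
  have : exp ((n : ℂ) * I * θ) * exp (-(m : ℂ) * I * θ) = exp (((n : ℂ) - m) * I * θ) := by
    rw [← exp_add]
    congr 1
    ring
  calc (r : ℂ) ^ n * exp ((n : ℂ) * I * θ) * ((r : ℂ) ^ m * exp (-(m : ℂ) * I * θ))
      = (r : ℂ) ^ n * (r : ℂ) ^ m * (exp ((n : ℂ) * I * θ) * exp (-(m : ℂ) * I * θ)) := by ring
    _ = (r : ℂ) ^ n * (r : ℂ) ^ m * exp (((n : ℂ) - m) * I * θ) := by rw [this]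

/-- **Finite Parseval on the circle**:
`∫_{(-π,π)} |Σ_{n<N} a_n (r e^{iθ})ⁿ|² dθ = 2π Σ_{n<N} |a_n|² r^{2n}`. -/
theorem integral_partialSum_sq (a : ℕ → ℂ) (N : ℕ) (r : ℝ) :
    ∫ θ in Set.Ioo (-π) π, ‖∑ n ∈ Finset.range N, a n * (circleMap 0 r θ) ^ n‖ ^ 2 =
      2 * π * ∑ n ∈ Finset.range N, ‖a n‖ ^ 2 * (r ^ 2) ^ n := by
  apply Complex.ofReal_injective
  rw [← integral_complex_ofReal]
  -- the integrand as a double sum of characters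
  have e : ∀ θ : ℝ, ((‖∑ n ∈ Finset.range N, a n * (circleMap 0 r θ) ^ n‖ ^ 2 : ℝ) : ℂ) =
      ∑ n ∈ Finset.range N, ∑ m ∈ Finset.range N,
        (a n * (starRingEnd ℂ) (a m) * (r : ℂ) ^ (n + m)) * exp (((n : ℂ) - m) * I * θ) := by
    intro θ
    rw [← Complex.normSq_eq_norm_sq, ← Complex.mul_conj, map_sum, Finset.sum_mul_sum]
    apply Finset.sum_congr rfl
    intro n _
    apply Finset.sum_congr rfl
    intro m _
    rw [map_mul, mul_mul_mul_comm, circleMap_zero_pow_mul_conj]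
    ring
  simp_rw [e]
  have hint : ∀ n m : ℕ, IntegrableOn (fun θ : ℝ =>
      (a n * (starRingEnd ℂ) (a m) * (r : ℂ) ^ (n + m)) * exp (((n : ℂ) - m) * I * θ))
      (Set.Ioo (-π) π) :=
    fun n m => ((by fun_prop : Continuous fun θ : ℝ =>
      (a n * (starRingEnd ℂ) (a m) * (r : ℂ) ^ (n + m)) * exp (((n : ℂ) - m) * I * θ)).integrableOn_Icc).mono_set
      Set.Ioo_subset_Icc_self
  rw [integral_finsetSum _ (fun n _ => integrable_finsetSum _ (fun m _ => hint n m)),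
    Finset.sum_congr rfl (fun n _ => integral_finsetSum _ (fun m _ => hint n m))]
  simp_rw [integral_const_mul, integral_Ioo_exp_sub, mul_ite, mul_zero]
  push_cast
  rw [Finset.mul_sum]
  apply Finset.sum_congr rfl
  intro n hn
  rw [Finset.sum_ite_eq (Finset.range N) n, if_pos hn, Complex.mul_conj, Complex.normSq_eq_norm_sq,
    ← two_mul, pow_mul]
  push_cast
  ring

/-! ### Summability and uniform convergence on compact discs -/

/-- **Absolute convergence inside the disc**: for a power series converging on `𝔻`,
`Σ_n |a_n| rⁿ < ∞` for `0 ≤ r < 1` (the terms at `r' = (1+r)/2` are bounded; geometric domination). -/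
theorem summable_norm_mul_pow (a : ℕ → ℂ) (f : ℂ → ℂ)
    (hf : ∀ z ∈ ball (0 : ℂ) 1, HasSum (fun n => a n * z ^ n) (f z)) {r : ℝ} (hr0 : 0 ≤ r)
    (hr : r < 1) : Summable (fun n => ‖a n‖ * r ^ n) := by
  set r' : ℝ := (1 + r) / 2 with hr'
  have hr'0 : 0 < r' := by rw [hr']; linarith
  have hrr' : r < r' := by rw [hr']; linarith
  have hr'1 : r' < 1 := by rw [hr']; linarith
  clear_value r'
  have hz : ((r' : ℝ) : ℂ) ∈ ball (0 : ℂ) 1 := by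
    rw [mem_ball_zero_iff, Complex.norm_real, Real.norm_eq_abs, abs_of_pos hr'0]
    exact hr'1
  have hs : Summable (fun n => a n * (r' : ℂ) ^ n) := (hf _ hz).summable
  have ht : Tendsto (fun n => ‖a n * (r' : ℂ) ^ n‖) atTop (𝓝 0) := by
    have := hs.tendsto_atTop_zero.norm
    simpa using this
  obtain ⟨M, hM⟩ := ht.bddAbove_range
  have hbound : ∀ n, ‖a n‖ * r ^ n ≤ M * (r / r') ^ n := by
    intro n
    have h1 : ‖a n * (r' : ℂ) ^ n‖ ≤ M := hM ⟨n, rfl⟩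
    rw [norm_mul, norm_pow, Complex.norm_real, Real.norm_eq_abs, abs_of_pos hr'0] at h1
    have e : ‖a n‖ * r ^ n = (‖a n‖ * r' ^ n) * (r / r') ^ n := by
      rw [div_pow]
      field_simp
    rw [e]
    exact mul_le_mul_of_nonneg_right h1 (by positivity)
  refine Summable.of_nonneg_of_le (fun n => by positivity) hbound ?_
  exact (summable_geometric_of_lt_one (by positivity) (by rwa [div_lt_one hr'0])).mul_left M

/-- **Weierstrass' M-test**: the partial sums converge uniformly to `f` on `|z| ≤ r < 1`. -/
theorem tendstoUniformlyOn_partialSum (a : ℕ → ℂ) (f : ℂ → ℂ)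
    (hf : ∀ z ∈ ball (0 : ℂ) 1, HasSum (fun n => a n * z ^ n) (f z)) {r : ℝ} (hr0 : 0 ≤ r)
    (hr : r < 1) :
    TendstoUniformlyOn (fun N z => ∑ n ∈ Finset.range N, a n * z ^ n) f atTop
      (closedBall (0 : ℂ) r) := by
  have hu := summable_norm_mul_pow a f hf hr0 hr
  have h := tendstoUniformlyOn_tsum_nat hu (f := fun n z => a n * z ^ n) (s := closedBall (0 : ℂ) r)
    (fun n z hz => by
      rw [norm_mul, norm_pow]
      exact mul_le_mul_of_nonneg_left
        (pow_le_pow_left₀ (norm_nonneg z) (mem_closedBall_zero_iff.mp hz) n) (norm_nonneg _))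
  exact h.congr_right fun z hz => (hf z (closedBall_subset_ball hr hz)).tsum_eq

/-- `f` is continuous on `|z| ≤ r < 1` (a uniform limit of polynomials). -/
theorem continuousOn_closedBall (a : ℕ → ℂ) (f : ℂ → ℂ)
    (hf : ∀ z ∈ ball (0 : ℂ) 1, HasSum (fun n => a n * z ^ n) (f z)) {r : ℝ} (hr0 : 0 ≤ r)
    (hr : r < 1) : ContinuousOn f (closedBall (0 : ℂ) r) :=
  (tendstoUniformlyOn_partialSum a f hf hr0 hr).continuousOn
    (Eventually.of_forall fun N => (by fun_prop : Continuous fun z : ℂ =>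
      ∑ n ∈ Finset.range N, a n * z ^ n).continuousOn).frequently

/-- Uniform convergence of the partial sums on the circle `|z| = r`, in the angle variable. -/
theorem tendstoUniformlyOn_partialSum_circle (a : ℕ → ℂ) (f : ℂ → ℂ)
    (hf : ∀ z ∈ ball (0 : ℂ) 1, HasSum (fun n => a n * z ^ n) (f z)) {r : ℝ} (hr0 : 0 ≤ r)
    (hr : r < 1) :
    TendstoUniformlyOn (fun N θ => ∑ n ∈ Finset.range N, a n * (circleMap 0 r θ) ^ n)
      (fun θ => f (circleMap 0 r θ)) atTop (Set.Icc (-π) π) := by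
  have h := (tendstoUniformlyOn_partialSum a f hf hr0 hr).comp (circleMap 0 r)
  refine h.mono fun θ _ => ?_
  show circleMap 0 r θ ∈ closedBall (0 : ℂ) r
  rw [mem_closedBall_zero_iff, norm_circleMap_zero, abs_of_nonneg hr0]

/-- If `F_N → f` uniformly on `s` and `|f| ≤ B` on `s`, then `|F_N|² → |f|²` uniformly on `s`. -/
theorem tendstoUniformlyOn_norm_sq {α : Type*} {F : ℕ → α → ℂ} {f : α → ℂ} {s : Set α}
    (h : TendstoUniformlyOn F f atTop s) {B : ℝ} (hB0 : 0 ≤ B) (hB : ∀ x ∈ s, ‖f x‖ ≤ B) :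
    TendstoUniformlyOn (fun N x => ‖F N x‖ ^ 2) (fun x => ‖f x‖ ^ 2) atTop s := by
  rw [Metric.tendstoUniformlyOn_iff] at h ⊢
  intro ε hε
  set δ : ℝ := min 1 (ε / (2 * B + 2)) with hδ
  have hδ0 : 0 < δ := lt_min one_pos (by positivity)
  have hδ1 : δ ≤ 1 := min_le_left _ _
  have hδ2 : δ ≤ ε / (2 * B + 2) := min_le_right _ _
  filter_upwards [h δ hδ0] with N hN x hx
  have h1 : ‖f x - F N x‖ < δ := by rw [← dist_eq_norm]; exact hN x hx
  have h2 : ‖F N x‖ ≤ ‖f x‖ + δ := by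
    have := norm_le_norm_add_norm_sub' (F N x) (f x)
    rw [norm_sub_rev] at this
    linarith
  have h3 : |‖f x‖ - ‖F N x‖| ≤ ‖f x - F N x‖ := abs_norm_sub_norm_le _ _
  rw [Real.dist_eq]
  have hfx := hB x hx
  have hFx : 0 ≤ ‖F N x‖ := norm_nonneg _
  have hfx0 : 0 ≤ ‖f x‖ := norm_nonneg _
  have e : ‖f x‖ ^ 2 - ‖F N x‖ ^ 2 = (‖f x‖ - ‖F N x‖) * (‖f x‖ + ‖F N x‖) := by ring
  rw [e, abs_mul, abs_of_nonneg (by positivity : (0 : ℝ) ≤ ‖f x‖ + ‖F N x‖)]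
  calc |‖f x‖ - ‖F N x‖| * (‖f x‖ + ‖F N x‖) ≤ δ * (2 * B + 1) := by
        apply mul_le_mul (h3.trans h1.le) (by linarith) (by positivity) hδ0.le
    _ < δ * (2 * B + 2) := by
        apply mul_lt_mul_of_pos_left (by linarith) hδ0
    _ ≤ ε / (2 * B + 2) * (2 * B + 2) := by
        apply mul_le_mul_of_nonneg_right hδ2 (by positivity)
    _ = ε := by field_simp

/-! ### Parseval on the circle -/

/-- **Parseval's identity on the circle `|z| = r`** for a power series converging on `𝔻`:
`Σ_n |a_n|² r^{2n} = (2π)⁻¹ ∫_{(-π,π)} |f(r e^{iθ})|² dθ` (as a `HasSum`), `0 ≤ r < 1`. -/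
theorem hasSum_circle_parseval (a : ℕ → ℂ) (f : ℂ → ℂ)
    (hf : ∀ z ∈ ball (0 : ℂ) 1, HasSum (fun n => a n * z ^ n) (f z)) {r : ℝ} (hr0 : 0 ≤ r)
    (hr : r < 1) :
    HasSum (fun n => ‖a n‖ ^ 2 * (r ^ 2) ^ n)
      ((2 * π)⁻¹ * ∫ θ in Set.Ioo (-π) π, ‖f (circleMap 0 r θ)‖ ^ 2) := by
  rw [hasSum_iff_tendsto_nat_of_nonneg (fun n => by positivity)]
  have e : ∀ N, ∑ n ∈ Finset.range N, ‖a n‖ ^ 2 * (r ^ 2) ^ n =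
      (2 * π)⁻¹ * ∫ θ in Set.Ioo (-π) π, ‖∑ n ∈ Finset.range N, a n * (circleMap 0 r θ) ^ n‖ ^ 2 := by
    intro N
    rw [integral_partialSum_sq]
    field_simp
  simp_rw [e]
  apply Tendsto.const_mul
  -- the bound on `f` on the circle
  obtain ⟨B, hB⟩ := (isCompact_closedBall (0 : ℂ) r).exists_bound_of_continuousOn
    (continuousOn_closedBall a f hf hr0 hr)
  have hB' : ∀ θ ∈ Set.Icc (-π) π, ‖f (circleMap 0 r θ)‖ ≤ max B 0 := fun θ _ =>
    (hB _ (by rw [mem_closedBall_zero_iff, norm_circleMap_zero, abs_of_nonneg hr0])).trans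
      (le_max_left _ _)
  have hunif := tendstoUniformlyOn_norm_sq (tendstoUniformlyOn_partialSum_circle a f hf hr0 hr)
    (le_max_right B 0) hB'
  have hcont : ∀ N, ContinuousOn (fun θ : ℝ => ‖∑ n ∈ Finset.range N, a n * (circleMap 0 r θ) ^ n‖ ^ 2)
      (Set.uIcc (-π) π) := fun N => (by fun_prop : Continuous fun θ : ℝ =>
    ‖∑ n ∈ Finset.range N, a n * (circleMap 0 r θ) ^ n‖ ^ 2).continuousOn
  have hππ : -π ≤ π := by linarith [Real.pi_pos]
  rw [← Set.uIcc_of_le hππ] at hunif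
  have key := hunif.tendsto_intervalIntegral_of_continuousOn (μ := volume)
    (hF := Eventually.of_forall hcont)
  simp_rw [intervalIntegral.integral_of_le hππ, integral_Ioc_eq_integral_Ioo] at key
  exact key

end Summit.Ventures.HodgeRepro2.T5CircleParseval
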